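import Summits.ValiantsHypothesis.ValiantsHypothesis.Theorems.KPlusLogSqLawTropicalShiftSquareDefs
import Summits.ValiantsHypothesis.ValiantsHypothesis.Theorems.KPlusLogSqLawTropicalShiftThree

/-!
# Route «KPlusLogSqLaw» — SHIFT-SQUARE, part 1: per-incidence scores and the domination inequalities

HONEST FRAMING.  Proof file (pure theorems) of the helper chain `--supports` the crux
`Summit.ValiantsHypothesis.ValiantsHypothesis.Theses.KPlusLogSqLaw.TropicalB` (item `stmt-ValiantsHypothesis-19771`, route
`KPlusLogSqLaw`; cell `pub-symmetroid`, seat val-sym-trop-p5 g8, 2026-08-27); the design is described in the definitions file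
`…TropicalShiftSquareDefs.lean`.  Nothing here asserts `TropicalB`, `WeakLifting`, `KPlusLogSqLaw`, `MatrixDescartes` or anything about
`VP ≠ VNP`; the `K = 4` fork of the cell (quadratic vs cubic growth of `T(m,4)`) is untouched.

THE ARGUMENT (SHIFT-THREE's, one class more).  The zero-sum gauge `θ(2m+3)·shift − θ·D·[wrap]` (`ShiftThree.sum_redistribute`,
imported) writes the tropical weight of ANY Leibniz term as `Σ_b φ_θ(σ b, b, λ b)` (`tropWeight_eq_sum_phi`).  For a PRESENT incidence
`φ = g_θ(q) + [low bit]·(θ − price(q, b))`, `q` the EFFECTIVE shift (a diagonal high incidence scores `θ·D = θ(2m+3)·m`, i.e. like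
shift `m`) and `g_θ(q) = θ(2m+3)q − pen q` (`phi_present`); the grid term's incidence in column `b` has effective shift `p` for every
phase `p ≤ m` (`eshift_cterm`) and scores `g_θ(p) + [b < a]·(θ − price(p, b))` (`phi_cterm`).  At `θ = θ(p,a) = L·p + 2a + 1`, for
ALL `p, a ≤ m`: `g(p) − g(q) > L·(p − q)` for `q < p` (SHIFT-THREE's `gval_gap_of_lt`) and `g(p) − g(q) > 0` for `q > p`
(`gval_gap_of_gt`, which only needs `a ≤ m`, not SHIFT-THREE's `a + p ≤ m` — this is why the grid is the full square), while the
low-bit bonus changes by at most the price difference (`bonus_le_of_lt/gt/eq`) and strictly drops when the low bit is wrong at the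
right shift (`bonus_lt_of_eq`: `θ − price(p,b) = 2(a − b) − 1` is odd); an incidence with effective shift `p` IS the grid entry with the
grid's high bit (`cell_of_eshift_eq`).  Part 2 (`…TropicalShiftSquareChain.lean`) sums this into dominance and runs the chain.
-/

set_option linter.dupNamespace false
set_option autoImplicit false

namespace Summit.ValiantsHypothesis.ValiantsHypothesis.Theorems.LacunarySymmetroidMatrixDescartes.TropicalCensus

open Summit.ValiantsHypothesis.ValiantsHypothesis.Theorems.MatrixDescartes.Negative
open scoped BigOperators
open Finset

namespace ShiftSquare

open ShiftThree (bigD shiftZ pen price th gval)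

variable (n : ℕ)

/-! ### elementary facts -/

/-- the cast of `D`: `D = (m)(2m+3)`. -/
theorem bigD_cast : (bigD n : ℤ) = ((n : ℤ) + 1) * (2 * n + 5) := by
  unfold ShiftThree.bigD; push_cast; ring

/-- `σ_p b = b + p (mod m)`, on values. -/
theorem rot_val_mod (p : ℕ) (b : Fin (n + 1)) : ((rot n p b : Fin (n + 1)) : ℕ) = ((b : ℕ) + p) % (n + 1) := by
  induction p with
  | zero =>
    unfold rot
    rw [pow_zero, Equiv.Perm.one_apply]
    exact (Nat.mod_eq_of_lt b.isLt).symm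
  | succ p ih =>
    unfold rot at ih ⊢
    rw [pow_succ', Equiv.Perm.mul_apply, finRotate_apply, Fin.val_add, ih, Fin.val_one', Nat.add_mod_mod,
      Nat.mod_add_mod, Nat.add_assoc]

/-- value of the phase permutation, `p ≤ m`: `σ_p b = b + p` reduced mod `m`. -/
theorem rot_val (p : ℕ) (hp : p ≤ n + 1) (b : Fin (n + 1)) :
    ((rot n p b : Fin (n + 1)) : ℕ) = if n + 1 ≤ (b : ℕ) + p then (b : ℕ) + p - (n + 1) else (b : ℕ) + p := by
  rw [rot_val_mod]
  have hb := b.isLt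
  by_cases h : n + 1 ≤ (b : ℕ) + p
  · rw [if_pos h, Nat.mod_eq_sub_mod h, Nat.mod_eq_of_lt (by omega)]
  · rw [if_neg h, Nat.mod_eq_of_lt (by omega)]

/-- every entry of `σ_p`, `p < m`, has shift `p`. -/
theorem shiftZ_rot_of_lt (p : ℕ) (hp : p < n + 1) (b : Fin (n + 1)) : shiftZ n (rot n p b) b = p := by
  unfold ShiftThree.shiftZ
  rw [rot_val n p (by omega)]
  split_ifs with h1 h2 h2 <;> omega

/-- the shift determines the row: an entry of column `b` with shift `p < m` is the phase-`p` entry. -/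
theorem eq_rot_of_shiftZ_eq_of_lt (p : ℕ) (hp : p < n + 1) (a b : Fin (n + 1)) (h : shiftZ n a b = p) :
    a = rot n p b := by
  apply Fin.ext
  rw [rot_val n p (by omega)]
  unfold ShiftThree.shiftZ at h
  by_cases h1 : (a : ℕ) < (b : ℕ)
  · rw [if_pos h1] at h
    by_cases h2 : n + 1 ≤ (b : ℕ) + p
    · rw [if_pos h2]; omega
    · rw [if_neg h2]; omega
  · rw [if_neg h1] at h
    by_cases h2 : n + 1 ≤ (b : ℕ) + p
    · rw [if_pos h2]; omega
    · rw [if_neg h2]; omega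

/-- the shift of any entry lies in `[0, m)`. -/
theorem shiftZ_bounds (a b : Fin (n + 1)) : 0 ≤ shiftZ n a b ∧ shiftZ n a b ≤ n := by
  have ha := a.isLt
  have hb := b.isLt
  unfold ShiftThree.shiftZ
  split_ifs with h <;> constructor <;> omega

/-- the effective shift lies in `[0, m]`. -/
theorem eshift_bounds (a b : Fin (n + 1)) (l : Fin 4) : 0 ≤ eshift n a b l ∧ eshift n a b l ≤ n + 1 := by
  unfold eshift
  split_ifs with h
  · constructor <;> linarith
  · have := shiftZ_bounds n a b
    constructor <;> linarith

/-- phase `m` is the identity. -/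
theorem rot_last_val (b : Fin (n + 1)) : ((rot n (n + 1) b : Fin (n + 1)) : ℕ) = b := by
  rw [rot_val n (n + 1) le_rfl, if_pos (by omega)]
  omega

/-- the effective shift of the grid incidence in column `b` is the phase `p` (for every `p ≤ m`). -/
theorem eshift_cterm (p a : ℕ) (hp : p ≤ n + 1) (b : Fin (n + 1)) :
    eshift n (rot n p b) b (lam n p a b) = p := by
  unfold eshift
  rcases Nat.lt_or_eq_of_le hp with hp' | hp'
  · rw [if_neg, shiftZ_rot_of_lt n p hp' b]
    rintro ⟨h1, h2⟩
    rw [rot_val n p hp] at h1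
    unfold lam at h2
    by_cases hw : n + 1 ≤ (b : ℕ) + p
    · rw [if_pos hw] at h1; omega
    · rw [if_neg hw] at h2
      split_ifs at h2 with hb
      · exact absurd h2 (by decide)
      · exact absurd h2 (by decide)
  · subst hp'
    rw [if_pos]
    · push_cast; ring
    · refine ⟨rot_last_val n b, ?_⟩
      unfold lam
      rw [if_pos (by omega)]
      split_ifs <;> decide

/-- the tropical weight is the sum of the corrected per-incidence scores (zero-sum gauge, `ShiftThree.sum_redistribute`). -/
theorem tropWeight_eq_sum_phi (θ : ℤ) (q : Equiv.Perm (Fin (n + 1)) × (Fin (n + 1) → Fin 4)) :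
    tropWeight (dd n) (vv n) θ q = ∑ b, phi n θ (q.1 b) b (q.2 b) := by
  unfold tropWeight phi
  have h0 := ShiftThree.sum_redistribute n q.1
  rw [Finset.sum_sub_distrib, Finset.sum_add_distrib, Finset.sum_sub_distrib, ← Finset.mul_sum]
  have h3 : ∑ b, θ * (2 * n + 5 : ℤ) * shiftZ n (q.1 b) b -
      ∑ b, θ * (bigD n : ℤ) * (if ((q.1 b : Fin (n + 1)) : ℕ) < (b : ℕ) then 1 else 0) = 0 := by
    rw [← Finset.sum_sub_distrib]
    have : ∀ b, θ * (2 * n + 5 : ℤ) * shiftZ n (q.1 b) b -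
        θ * (bigD n : ℤ) * (if ((q.1 b : Fin (n + 1)) : ℕ) < (b : ℕ) then 1 else 0)
        = θ * ((2 * n + 5 : ℤ) * shiftZ n (q.1 b) b -
          (bigD n : ℤ) * (if ((q.1 b : Fin (n + 1)) : ℕ) < (b : ℕ) then 1 else 0)) := fun b => by ring
    rw [Finset.sum_congr rfl (fun b _ => this b), ← Finset.mul_sum, h0, mul_zero]
  linarith

/-! ### per-incidence scores -/

/-- the exponent of class `l` in two-bit form: `D·[2 ≤ l] + [l odd]`. -/
theorem dd_eq (l : Fin 4) :
    (dd n l : ℤ) = (if 2 ≤ (l : ℕ) then (bigD n : ℤ) else 0) + (if (l : ℕ) % 2 = 1 then 1 else 0) := by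
  fin_cases l <;> simp [dd]

/-- score of a PRESENT incidence: `g_θ(effective shift) + [low bit]·(θ − price)`. -/
theorem phi_present (θ : ℤ) (a b : Fin (n + 1)) (l : Fin 4) (h : ee n a b l ≠ 0) :
    phi n θ a b l = gval n θ (eshift n a b l) +
      (if (l : ℕ) % 2 = 1 then θ - price n (eshift n a b l) b else 0) := by
  have hdd := dd_eq n l
  unfold phi ShiftThree.gval vv eshift
  rw [hdd]
  unfold ee at h
  by_cases hw : (a : ℕ) < (b : ℕ)
  · -- wrapping entry: high classes only
    rw [if_pos hw] at h
    have hl : 2 ≤ (l : ℕ) := by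
      by_contra hl; exact h (by rw [if_neg hl])
    have hne : ¬ ((a : ℕ) = (b : ℕ) ∧ 2 ≤ (l : ℕ)) := fun h' => by omega
    simp only [if_neg hne, if_pos hw, if_pos hl]
    by_cases ho : (l : ℕ) % 2 = 1
    · simp only [if_pos ho]; ring
    · simp only [if_neg ho]; ring
  · rw [if_neg hw] at h
    simp only [if_neg hw]
    by_cases hd : (a : ℕ) = (b : ℕ)
    · -- diagonal entry: all four classes
      have hs : shiftZ n a b = 0 := by
        unfold ShiftThree.shiftZ; rw [if_neg hw]; omega
      by_cases hl : 2 ≤ (l : ℕ)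
      · have hD := bigD_cast n
        have hdl : (a : ℕ) = (b : ℕ) ∧ 2 ≤ (l : ℕ) := ⟨hd, hl⟩
        simp only [if_pos hdl, if_pos hl, hs, hD]
        by_cases ho : (l : ℕ) % 2 = 1
        · simp only [if_pos ho]; ring
        · simp only [if_neg ho]; ring
      · simp only [if_neg (fun h' : (a : ℕ) = (b : ℕ) ∧ 2 ≤ (l : ℕ) => hl h'.2), if_neg hl]
        by_cases ho : (l : ℕ) % 2 = 1
        · simp only [if_pos ho]; ring
        · simp only [if_neg ho]; ring
    · -- entry below the diagonal: low classes only
      rw [if_neg hd] at h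
      have hl : ¬ 2 ≤ (l : ℕ) := by
        intro hl; exact h (by rw [if_pos hl])
      simp only [if_neg (fun h' : (a : ℕ) = (b : ℕ) ∧ 2 ≤ (l : ℕ) => hd h'.1), if_neg hl]
      by_cases ho : (l : ℕ) % 2 = 1
      · simp only [if_pos ho]; ring
      · simp only [if_neg ho]; ring

/-! ### the grid incidences -/

/-- the low bit of the grid class in column `b` is `[b < a]`. -/
theorem lam_mod_two (p a : ℕ) (b : Fin (n + 1)) : ((lam n p a b : Fin 4) : ℕ) % 2 = 1 ↔ (b : ℕ) < a := by
  unfold lam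
  split_ifs with h1 h2 h2 <;> simp [h2]

/-- the high bit of the grid class in column `b` is `[m ≤ b + p]`. -/
theorem lam_high (p a : ℕ) (b : Fin (n + 1)) : 2 ≤ ((lam n p a b : Fin 4) : ℕ) ↔ n + 1 ≤ (b : ℕ) + p := by
  unfold lam
  split_ifs with h1 h2 h2 <;> simp [h1]

/-- the sign of the grid incidence in column `b`: `−1` iff `b < a` (every grid incidence is present). -/
theorem ee_cterm (p a : ℕ) (hp : p ≤ n + 1) (b : Fin (n + 1)) :
    ee n (rot n p b) b (lam n p a b) = if (b : ℕ) < a then -1 else 1 := by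
  have hv := rot_val n p hp b
  have hls : lsign (lam n p a b) = if (b : ℕ) < a then -1 else 1 := by
    unfold lsign
    by_cases hb : (b : ℕ) < a
    · rw [if_pos ((lam_mod_two n p a b).mpr hb), if_pos hb]
    · rw [if_neg (fun h => hb ((lam_mod_two n p a b).mp h)), if_neg hb]
  unfold ee
  by_cases hw : n + 1 ≤ (b : ℕ) + p
  · have hhi : 2 ≤ ((lam n p a b : Fin 4) : ℕ) := (lam_high n p a b).mpr hw
    rw [if_pos hw] at hv
    rcases Nat.lt_or_eq_of_le hp with hp' | hp'
    · have hlt : ((rot n p b : Fin (n + 1)) : ℕ) < (b : ℕ) := by rw [hv]; omega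
      rw [if_pos hlt, if_pos hhi, hls]
    · have heq : ((rot n p b : Fin (n + 1)) : ℕ) = (b : ℕ) := by rw [hv]; omega
      rw [if_neg (by omega), if_pos heq, hls]
  · have hlo : ¬ 2 ≤ ((lam n p a b : Fin 4) : ℕ) := fun h => hw ((lam_high n p a b).mp h)
    rw [if_neg hw] at hv
    have hge : ¬ ((rot n p b : Fin (n + 1)) : ℕ) < (b : ℕ) := by rw [hv]; omega
    rw [if_neg hge]
    by_cases heq : ((rot n p b : Fin (n + 1)) : ℕ) = (b : ℕ)
    · rw [if_pos heq, hls]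
    · rw [if_neg heq, if_neg hlo, hls]

/-- every incidence of a grid term is present. -/
theorem ee_cterm_ne_zero (p a : ℕ) (hp : p ≤ n + 1) (b : Fin (n + 1)) :
    ee n (rot n p b) b (lam n p a b) ≠ 0 := by
  rw [ee_cterm n p a hp]
  split_ifs <;> norm_num

/-- score of the grid incidence in column `b` at slope `θ`: `g_θ(p) + [b < a]·(θ − price(p, b))`. -/
theorem phi_cterm (θ : ℤ) (p a : ℕ) (hp : p ≤ n + 1) (b : Fin (n + 1)) :
    phi n θ (rot n p b) b (lam n p a b) = gval n θ p + (if (b : ℕ) < a then θ - price n p b else 0) := by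
  rw [phi_present n θ _ b _ (ee_cterm_ne_zero n p a hp b), eshift_cterm n p a hp]
  by_cases hb : (b : ℕ) < a
  · rw [if_pos ((lam_mod_two n p a b).mpr hb), if_pos hb]
  · rw [if_neg (fun h => hb ((lam_mod_two n p a b).mp h)), if_neg hb]

/-! ### the domination inequalities (pure arithmetic; `gval_sub`, `gval_gap_of_lt`, `price_sub`, `th_sub_price` are SHIFT-THREE's) -/

/-- a larger (effective) shift loses outright, for every step `a ≤ m` of the phase. -/
theorem gval_gap_of_gt (p a : ℕ) (ha : a ≤ n + 1) (q : ℤ) (hq : (p : ℤ) < q) :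
    0 < gval n (th n p a) p - gval n (th n p a) q := by
  rw [ShiftThree.gval_sub]
  unfold ShiftThree.th
  have h1 : (1 : ℤ) ≤ q - p := by linarith
  have ha' : (a : ℤ) ≤ n + 1 := by exact_mod_cast ha
  have hF : (1 : ℤ) ≤ (n + 2) * ((p : ℤ) + q + 1) - ((2 * n + 4) * p + 2 * a + 1) := by nlinarith
  have h2 : (2 * n + 5 : ℤ) * (p - q) * ((2 * n + 4) * p + 2 * a + 1 - (n + 2) * (p + q + 1))
      = (2 * n + 5) * (q - p) * ((n + 2) * ((p : ℤ) + q + 1) - ((2 * n + 4) * p + 2 * a + 1)) := by ring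
  rw [h2]
  have h3 : (0 : ℤ) < 2 * n + 5 := by positivity
  positivity

/-- bonus comparison, rival shift below the phase. -/
theorem bonus_le_of_lt (p a : ℕ) (b : Fin (n + 1)) (l : Fin 4) (q : ℤ) (hq : q < p) :
    (if (l : ℕ) % 2 = 1 then th n p a - price n q b else 0) ≤
      (if (b : ℕ) < a then th n p a - price n p b else 0) + (2 * n + 4) * ((p : ℤ) - q) := by
  have hΔ : (0 : ℤ) ≤ (2 * n + 4) * ((p : ℤ) - q) :=
    mul_nonneg (by positivity) (by linarith)
  have hq' : th n p a - price n q b = (th n p a - price n p b) + (2 * n + 4) * ((p : ℤ) - q) := by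
    have := ShiftThree.price_sub n p q b; linarith
  have ht := ShiftThree.th_sub_price n p a b
  by_cases h1 : (l : ℕ) % 2 = 1
  · rw [if_pos h1, hq']
    by_cases h2 : (b : ℕ) < a
    · rw [if_pos h2]
    · rw [if_neg h2]
      have : (a : ℤ) ≤ b := by exact_mod_cast Nat.le_of_not_lt h2
      linarith
  · rw [if_neg h1]
    by_cases h2 : (b : ℕ) < a
    · rw [if_pos h2]
      have : (b : ℤ) + 1 ≤ a := by exact_mod_cast h2
      linarith
    · rw [if_neg h2]; linarith

/-- bonus comparison, rival shift above the phase. -/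
theorem bonus_le_of_gt (p a : ℕ) (b : Fin (n + 1)) (l : Fin 4) (q : ℤ) (hq : (p : ℤ) < q) :
    (if (l : ℕ) % 2 = 1 then th n p a - price n q b else 0) ≤
      (if (b : ℕ) < a then th n p a - price n p b else 0) := by
  have hΔ : (0 : ℤ) < (2 * n + 4) * (q - (p : ℤ)) := mul_pos (by positivity) (by linarith)
  have hq' : th n p a - price n q b = (th n p a - price n p b) - (2 * n + 4) * (q - (p : ℤ)) := by
    have := ShiftThree.price_sub n p q b; linarith
  have ht := ShiftThree.th_sub_price n p a b
  by_cases h1 : (l : ℕ) % 2 = 1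
  · rw [if_pos h1, hq']
    by_cases h2 : (b : ℕ) < a
    · rw [if_pos h2]; linarith
    · rw [if_neg h2]
      have : (a : ℤ) ≤ b := by exact_mod_cast Nat.le_of_not_lt h2
      linarith
  · rw [if_neg h1]
    by_cases h2 : (b : ℕ) < a
    · rw [if_pos h2]
      have : (b : ℤ) + 1 ≤ a := by exact_mod_cast h2
      linarith
    · rw [if_neg h2]

/-- bonus comparison, same shift: weak form … -/
theorem bonus_le_of_eq (p a : ℕ) (b : Fin (n + 1)) (l : Fin 4) :
    (if (l : ℕ) % 2 = 1 then th n p a - price n p b else 0) ≤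
      (if (b : ℕ) < a then th n p a - price n p b else 0) := by
  have ht := ShiftThree.th_sub_price n p a b
  by_cases h1 : (l : ℕ) % 2 = 1
  · rw [if_pos h1]
    by_cases h2 : (b : ℕ) < a
    · rw [if_pos h2]
    · rw [if_neg h2]
      have : (a : ℤ) ≤ b := by exact_mod_cast Nat.le_of_not_lt h2
      linarith
  · rw [if_neg h1]
    by_cases h2 : (b : ℕ) < a
    · rw [if_pos h2]
      have : (b : ℤ) + 1 ≤ a := by exact_mod_cast h2
      linarith
    · rw [if_neg h2]

/-- … and strict form: a different low bit at the same shift scores strictly less (the bonus `2(a − b) − 1` is odd). -/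
theorem bonus_lt_of_eq (p a : ℕ) (b : Fin (n + 1)) (l : Fin 4) (hl : ¬ ((l : ℕ) % 2 = 1 ↔ (b : ℕ) < a)) :
    (if (l : ℕ) % 2 = 1 then th n p a - price n p b else 0) <
      (if (b : ℕ) < a then th n p a - price n p b else 0) := by
  have ht := ShiftThree.th_sub_price n p a b
  by_cases h1 : (l : ℕ) % 2 = 1
  · rw [if_pos h1]
    have h2 : ¬ (b : ℕ) < a := fun h2 => hl ⟨fun _ => h2, fun _ => h1⟩
    rw [if_neg h2]
    have : (a : ℤ) ≤ b := by exact_mod_cast Nat.le_of_not_lt h2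
    linarith
  · rw [if_neg h1]
    have h2 : (b : ℕ) < a := by
      by_contra h2; exact hl ⟨fun h => absurd h h1, fun h => absurd h h2⟩
    rw [if_pos h2]
    have : (b : ℤ) + 1 ≤ a := by exact_mod_cast h2
    linarith

/-! ### identification of an incidence by its effective shift -/

/-- a present incidence with effective shift `p ≤ m` sits on the phase-`p` entry of its column and has the grid's high bit. -/
theorem cell_of_eshift_eq (p : ℕ) (hp : p ≤ n + 1) (a' b : Fin (n + 1)) (l : Fin 4) (h : ee n a' b l ≠ 0)
    (hq : eshift n a' b l = p) : a' = rot n p b ∧ (2 ≤ (l : ℕ) ↔ n + 1 ≤ (b : ℕ) + p) := by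
  unfold eshift at hq
  unfold ee at h
  by_cases hdh : (a' : ℕ) = (b : ℕ) ∧ 2 ≤ (l : ℕ)
  · rw [if_pos hdh] at hq
    have hp' : p = n + 1 := by omega
    subst hp'
    refine ⟨Fin.ext ?_, ⟨fun _ => by omega, fun _ => hdh.2⟩⟩
    rw [rot_last_val]; exact hdh.1
  · rw [if_neg hdh] at hq
    have hpn : p < n + 1 := by have := shiftZ_bounds n a' b; omega
    have ha' : a' = rot n p b := eq_rot_of_shiftZ_eq_of_lt n p hpn a' b hq
    refine ⟨ha', ?_⟩
    have hv := rot_val n p hp b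
    rw [← ha'] at hv
    by_cases hw : (a' : ℕ) < (b : ℕ)
    · rw [if_pos hw] at h
      have hl : 2 ≤ (l : ℕ) := by by_contra hl; exact h (by rw [if_neg hl])
      refine ⟨fun _ => ?_, fun _ => hl⟩
      by_contra hw'
      rw [if_neg hw'] at hv; omega
    · rw [if_neg hw] at h
      have hw' : ¬ n + 1 ≤ (b : ℕ) + p := by
        intro hw'
        rw [if_pos hw'] at hv; omega
      refine ⟨fun hl => ?_, fun h' => absurd h' hw'⟩
      exfalso
      by_cases hd : (a' : ℕ) = (b : ℕ)
      · exact hdh ⟨hd, hl⟩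
      · rw [if_neg hd, if_pos hl] at h
        exact h rfl

end ShiftSquare

end Summit.ValiantsHypothesis.ValiantsHypothesis.Theorems.LacunarySymmetroidMatrixDescartes.TropicalCensus
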